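import Summits.AtomisticToContinuum.BoseEinsteinCondensation.Theses.BECEqualScatteringTransfer
import Summits.AtomisticToContinuum.BoseEinsteinCondensation.Theses.BECChargeConjugationRP
import Literature.MathematicalPhysics.QuantumManyBody.GroundState

/-!
# Line `slack` for the crux `ScatteringLengthTransfer` (stmt-AtomisticToContinuum-9048)

Strategist line (alternative to `Lines/birth.lean`; it does NOT replace it).

Crux (fixed, by name): for admissible `v` (bounded) and `w` (arbitrary admissible: hard cores, porous
`⊤`-sets, unbounded finite parts allowed) with `scatteringLength v = scatteringLength w`, small-density
Dirichlet ground-state BEC for `v` implies small-density ground-state BEC for `w`.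

LINE "read the source on ground states, write the target with ENERGY SLACK, meet the target class by
INCLUSION of near-minimiser sets":

* `stub_condensedGroundState` (CGE; fixed `(N, L)`, bounded source; provable functional analysis —
  ONE HALF of birth's CGS, no uniqueness / Perron–Frobenius): if `m ≤ condensateNumber v N L` and
  `m' < m` then some Dirichlet ground state `Ψ` of `v` (a minimiser of the closed form,
  `IsGroundState`) has `λ_max(γ_Ψ) ≥ m'` (minimising sequences are bounded in `H¹₀(Λ_L^N)`, Rellich
  gives an `L²`-convergent subsequence, `IsGroundState.of_tendstoL2`, and `maxOccupation` is
  `L²`-continuous at fixed `N`).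
* `stub_slackSoftening` (SSF; fixed `(N, L)`; provable): every admissible `w` is met, at each fixed
  volume and each target slack `δ₀ > 0`, by a TAME admissible `u` (`u r = ⊤ ∨ u r ≤ M`: hard
  obstacle plus bounded part) of range `≤ R(w)` and the SAME scattering length such that every
  `δ`-near-minimiser of `w` is a `δ₀`-near-minimiser of `u` (for tame `w` take `u = w`, `δ = δ₀`; in
  general keep the `⊤`-set of `w`, truncate the finite part at height `n` and add a thin compensating
  shell fixed by the intermediate value theorem; monotone convergence of the fixed-volume ground-state
  ENERGIES `E₀(min) ↑ E₀(w)` — no ground STATES, no uniqueness, no connectivity of the hard-sphere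
  configuration space are needed, because inclusion of near-minimiser sets replaces convergence of
  minimisers).
* `stub_uniformSlackTransfer` (UST; the thermodynamic-limit heart): if the ground states of the bounded
  source `v` at density `ρ < ρ₁(v, R)` carry `λ_max ≥ c₀ N` eventually, then ONE constant `c > 0` and,
  for all large `N`, ONE slack `δ₀(N) > 0` give `λ_max(γ_Φ) ≥ c N` for EVERY `δ₀`-near-minimiser `Φ`
  of EVERY tame admissible `u` of range `≤ R` with `scatteringLength u = scatteringLength v` (hard cores
  included: the heart meets them directly, in the currency — all near-minimisers at explicit slack —
  that operator inequalities `H_u − E₀(u) ≥ κ 𝒩₊ − error` output; physically any `δ₀ ≪ N/L²` is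
  harmless, and `δ₀` may here even depend on `N`).
* `ScatteringLengthTransfer_of`: CGE → SSF → UST → crux, sorry-free; concludes the bet route's decl
  `…Theses.BECEqualScatteringTransfer.ScatteringLengthTransfer` BY NAME (definitionally equal to the
  other three route copies of this shared crux). The only tree facts used are `le_condensateNumber`
  (how BEC is proved: exhibit a slack and a bound for all near-minimisers) and `Real.rpow_pos_of_pos`.
* `ScatteringLengthTransfer_proof`: the same term at the type of the item's primary-route copy
  (`…Theses.BECChargeConjugationRP.ScatteringLengthTransfer`); it inherits the stubs' `sorry` and is
  NOT a proof.
-/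

namespace Summit.AtomisticToContinuum.BoseEinsteinCondensation.Cruxes.ScatteringLengthTransfer.Slack

open Filter

/-- **CGE — a condensed ground state from a condensate-number bound (bounded potentials, fixed
volume).** For a bounded admissible `v`, `N ≥ 1`, `L > 0`: if `m ≤ condensateNumber v N L` and
`m' < m`, some Dirichlet ground state `Ψ` (`IsGroundState v L Ψ`) has `m' ≤ λ_max(γ_Ψ)`.
Size: XL in Lean (Rellich–Kondrachov on `Λ_L^N`, absent from Mathlib), no open mathematics; strictly
weaker than birth's CGS (existence + `≥`, never uniqueness). -/
theorem stub_condensedGroundState :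
    ∀ v : ℝ → ENNReal,
      Literature.MathematicalPhysics.QuantumManyBody.BoseGas.IsRepulsiveFiniteRange v →
      (∃ M : NNReal, ∀ r, v r ≤ M) → ∀ N : ℕ, 0 < N → ∀ L : ℝ, 0 < L → ∀ m m' : ENNReal, m' < m →
        m ≤ Literature.MathematicalPhysics.QuantumManyBody.BoseGas.condensateNumber v N L →
        ∃ Ψ : Literature.MathematicalPhysics.QuantumManyBody.BoseGas.Config N → ℂ,
          Literature.MathematicalPhysics.QuantumManyBody.BoseGas.IsGroundState v L Ψ ∧
          m' ≤ Literature.MathematicalPhysics.QuantumManyBody.BoseGas.maxOccupation N Ψ := by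
  sorry

/-- **SSF — slack softening by inclusion of near-minimiser sets (fixed volume).** For every
admissible `w` there is a range bound `R > 0` such that for all `N ≥ 1`, `L > 0` and every target
slack `δ₀ > 0` there are `δ > 0` and a TAME admissible `u` (`∀ r, u r = ⊤ ∨ u r ≤ M` for one
`M : ℝ≥0`) of range `≤ R` with `scatteringLength u = scatteringLength w`, such that every
`δ`-near-minimiser of the `w`-energy is a `δ₀`-near-minimiser of the `u`-energy. For tame `w` this is
`u = w`, `δ = δ₀`; for a general `w` keep its `⊤`-set, truncate the finite part and compensate the
scattering length by a thin shell (IVT), using `E₀(truncation) ↑ E₀(w)` at fixed `(N, L)`.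
Size: L in Lean (monotone convergence of fixed-volume ground-state ENERGIES; no ground states),
no open mathematics. -/
theorem stub_slackSoftening :
    ∀ w : ℝ → ENNReal,
      Literature.MathematicalPhysics.QuantumManyBody.BoseGas.IsRepulsiveFiniteRange w →
      ∃ R : ℝ, 0 < R ∧ ∀ (N : ℕ) (L : ℝ), 0 < N → 0 < L → ∀ δ₀ : ENNReal, 0 < δ₀ →
        ∃ δ : ENNReal, 0 < δ ∧ ∃ u : ℝ → ENNReal,
          Literature.MathematicalPhysics.QuantumManyBody.BoseGas.IsRepulsiveFiniteRange u ∧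
          (∃ M : NNReal, ∀ r, u r = ⊤ ∨ u r ≤ M) ∧ (∀ r, R < r → u r = 0) ∧
          Literature.MathematicalPhysics.QuantumManyBody.BoseGas.scatteringLength u =
            Literature.MathematicalPhysics.QuantumManyBody.BoseGas.scatteringLength w ∧
          ∀ Ψ : Literature.MathematicalPhysics.QuantumManyBody.BoseGas.TrialState N L,
            Literature.MathematicalPhysics.QuantumManyBody.BoseGas.energy w Ψ ≤
              Literature.MathematicalPhysics.QuantumManyBody.BoseGas.groundStateEnergy w N L + δ →
            Literature.MathematicalPhysics.QuantumManyBody.BoseGas.energy u Ψ ≤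
              Literature.MathematicalPhysics.QuantumManyBody.BoseGas.groundStateEnergy u N L + δ₀ := by
  sorry

/-- **UST — uniform slack transfer along the thermodynamic sequence (the heart).** For a bounded
admissible source `v` and a range bound `R > 0` there is `ρ₁ > 0` such that for every density
`0 < ρ < ρ₁` and every `c₀ > 0`: if eventually in `N` some ground state of `v` in the box of side
`(N/ρ)^{1/3}` has `λ_max(γ) ≥ c₀ N`, then ONE constant `c > 0` and, for all large `N`, ONE slack
`δ₀ > 0` (allowed to depend on `N`) give `λ_max(γ_Φ) ≥ c N` for every `δ₀`-near-minimiser `Φ` of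
EVERY tame admissible `u` of range `≤ R` with `scatteringLength u = scatteringLength v` — hard cores
and porous obstacles included. Size: open-problem level (the N-uniform equal-`a` transfer), stated in
the slack currency of operator inequalities; a STRENGTHENING of the crux's tame-target case. -/
theorem stub_uniformSlackTransfer :
    ∀ v : ℝ → ENNReal,
      Literature.MathematicalPhysics.QuantumManyBody.BoseGas.IsRepulsiveFiniteRange v →
      (∃ M : NNReal, ∀ r, v r ≤ M) → ∀ R : ℝ, 0 < R → ∃ ρ₁ : ℝ, 0 < ρ₁ ∧
        ∀ ρ : ℝ, 0 < ρ → ρ < ρ₁ → ∀ c₀ : ℝ, 0 < c₀ →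
          (∀ᶠ N : ℕ in Filter.atTop,
            ∃ Ψ : Literature.MathematicalPhysics.QuantumManyBody.BoseGas.Config N → ℂ,
              Literature.MathematicalPhysics.QuantumManyBody.BoseGas.IsGroundState v
                (Literature.MathematicalPhysics.QuantumManyBody.BoseGas.sideLength ρ N) Ψ ∧
              ENNReal.ofReal (c₀ * N) ≤
                Literature.MathematicalPhysics.QuantumManyBody.BoseGas.maxOccupation N Ψ) →
          ∃ c : ℝ, 0 < c ∧ ∀ᶠ N : ℕ in Filter.atTop, ∃ δ₀ : ENNReal, 0 < δ₀ ∧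
            ∀ u : ℝ → ENNReal,
              Literature.MathematicalPhysics.QuantumManyBody.BoseGas.IsRepulsiveFiniteRange u →
              (∃ M : NNReal, ∀ r, u r = ⊤ ∨ u r ≤ M) → (∀ r, R < r → u r = 0) →
              Literature.MathematicalPhysics.QuantumManyBody.BoseGas.scatteringLength u =
                Literature.MathematicalPhysics.QuantumManyBody.BoseGas.scatteringLength v →
              ∀ Φ : Literature.MathematicalPhysics.QuantumManyBody.BoseGas.TrialState N
                  (Literature.MathematicalPhysics.QuantumManyBody.BoseGas.sideLength ρ N),
                Literature.MathematicalPhysics.QuantumManyBody.BoseGas.energy u Φ ≤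
                  Literature.MathematicalPhysics.QuantumManyBody.BoseGas.groundStateEnergy u N
                    (Literature.MathematicalPhysics.QuantumManyBody.BoseGas.sideLength ρ N) + δ₀ →
                ENNReal.ofReal (c * N) ≤
                  Literature.MathematicalPhysics.QuantumManyBody.BoseGas.maxOccupation N Φ.ψ := by
  sorry

/-- **Assembly of the line**: CGE → SSF → UST → `ScatteringLengthTransfer` (the bet route's decl, by
name). Given `v, w` with equal scattering length and BEC of `v` below `ρ₀`: SSF for `w` gives `R`;
UST for `v, R` gives `ρ₁`; for `ρ < min ρ₀ ρ₁`, CGE turns `ofReal (c₀ N) ≤ condensateNumber v N L_N`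
into a ground state with `λ_max ≥ (c₀/2) N`, UST gives `c` and, for large `N`, a slack `δ₀` that
serves every tame equal-`a` `u` of range `≤ R`; SSF at the fixed volume `L_N` and slack `δ₀`
produces such a `u` together with a `δ` for which every `δ`-near-minimiser of `w` is a
`δ₀`-near-minimiser of `u`, hence has `λ_max ≥ c N`; `le_condensateNumber` turns "all
`δ`-near-minimisers" into `ofReal (c N) ≤ condensateNumber w N L_N`. -/
theorem ScatteringLengthTransfer_of :
    (∀ v : ℝ → ENNReal,
      Literature.MathematicalPhysics.QuantumManyBody.BoseGas.IsRepulsiveFiniteRange v →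
      (∃ M : NNReal, ∀ r, v r ≤ M) → ∀ N : ℕ, 0 < N → ∀ L : ℝ, 0 < L → ∀ m m' : ENNReal, m' < m →
        m ≤ Literature.MathematicalPhysics.QuantumManyBody.BoseGas.condensateNumber v N L →
        ∃ Ψ : Literature.MathematicalPhysics.QuantumManyBody.BoseGas.Config N → ℂ,
          Literature.MathematicalPhysics.QuantumManyBody.BoseGas.IsGroundState v L Ψ ∧
          m' ≤ Literature.MathematicalPhysics.QuantumManyBody.BoseGas.maxOccupation N Ψ) →
    (∀ w : ℝ → ENNReal,
      Literature.MathematicalPhysics.QuantumManyBody.BoseGas.IsRepulsiveFiniteRange w →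
      ∃ R : ℝ, 0 < R ∧ ∀ (N : ℕ) (L : ℝ), 0 < N → 0 < L → ∀ δ₀ : ENNReal, 0 < δ₀ →
        ∃ δ : ENNReal, 0 < δ ∧ ∃ u : ℝ → ENNReal,
          Literature.MathematicalPhysics.QuantumManyBody.BoseGas.IsRepulsiveFiniteRange u ∧
          (∃ M : NNReal, ∀ r, u r = ⊤ ∨ u r ≤ M) ∧ (∀ r, R < r → u r = 0) ∧
          Literature.MathematicalPhysics.QuantumManyBody.BoseGas.scatteringLength u =
            Literature.MathematicalPhysics.QuantumManyBody.BoseGas.scatteringLength w ∧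
          ∀ Ψ : Literature.MathematicalPhysics.QuantumManyBody.BoseGas.TrialState N L,
            Literature.MathematicalPhysics.QuantumManyBody.BoseGas.energy w Ψ ≤
              Literature.MathematicalPhysics.QuantumManyBody.BoseGas.groundStateEnergy w N L + δ →
            Literature.MathematicalPhysics.QuantumManyBody.BoseGas.energy u Ψ ≤
              Literature.MathematicalPhysics.QuantumManyBody.BoseGas.groundStateEnergy u N L + δ₀) →
    (∀ v : ℝ → ENNReal,
      Literature.MathematicalPhysics.QuantumManyBody.BoseGas.IsRepulsiveFiniteRange v →
      (∃ M : NNReal, ∀ r, v r ≤ M) → ∀ R : ℝ, 0 < R → ∃ ρ₁ : ℝ, 0 < ρ₁ ∧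
        ∀ ρ : ℝ, 0 < ρ → ρ < ρ₁ → ∀ c₀ : ℝ, 0 < c₀ →
          (∀ᶠ N : ℕ in Filter.atTop,
            ∃ Ψ : Literature.MathematicalPhysics.QuantumManyBody.BoseGas.Config N → ℂ,
              Literature.MathematicalPhysics.QuantumManyBody.BoseGas.IsGroundState v
                (Literature.MathematicalPhysics.QuantumManyBody.BoseGas.sideLength ρ N) Ψ ∧
              ENNReal.ofReal (c₀ * N) ≤
                Literature.MathematicalPhysics.QuantumManyBody.BoseGas.maxOccupation N Ψ) →
          ∃ c : ℝ, 0 < c ∧ ∀ᶠ N : ℕ in Filter.atTop, ∃ δ₀ : ENNReal, 0 < δ₀ ∧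
            ∀ u : ℝ → ENNReal,
              Literature.MathematicalPhysics.QuantumManyBody.BoseGas.IsRepulsiveFiniteRange u →
              (∃ M : NNReal, ∀ r, u r = ⊤ ∨ u r ≤ M) → (∀ r, R < r → u r = 0) →
              Literature.MathematicalPhysics.QuantumManyBody.BoseGas.scatteringLength u =
                Literature.MathematicalPhysics.QuantumManyBody.BoseGas.scatteringLength v →
              ∀ Φ : Literature.MathematicalPhysics.QuantumManyBody.BoseGas.TrialState N
                  (Literature.MathematicalPhysics.QuantumManyBody.BoseGas.sideLength ρ N),
                Literature.MathematicalPhysics.QuantumManyBody.BoseGas.energy u Φ ≤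
                  Literature.MathematicalPhysics.QuantumManyBody.BoseGas.groundStateEnergy u N
                    (Literature.MathematicalPhysics.QuantumManyBody.BoseGas.sideLength ρ N) + δ₀ →
                ENNReal.ofReal (c * N) ≤
                  Literature.MathematicalPhysics.QuantumManyBody.BoseGas.maxOccupation N Φ.ψ) →
    Summit.AtomisticToContinuum.BoseEinsteinCondensation.Theses.BECEqualScatteringTransfer.ScatteringLengthTransfer := by
  intro hCGE hSSF hUST v w hv hw hvM hvw hBECv
  obtain ⟨ρ₀, hρ₀, hBEC⟩ := hBECv
  obtain ⟨R, hR, hS⟩ := hSSF w hw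
  obtain ⟨ρ₁, hρ₁, hT⟩ := hUST v hv hvM R hR
  refine ⟨min ρ₀ ρ₁, lt_min hρ₀ hρ₁, fun ρ hρ hρlt => ?_⟩
  have h0 : ρ < ρ₀ := hρlt.trans_le (min_le_left _ _)
  have h1 : ρ < ρ₁ := hρlt.trans_le (min_le_right _ _)
  -- side lengths are positive along the thermodynamic sequence
  have hL : ∀ N : ℕ, 0 < N →
      0 < Literature.MathematicalPhysics.QuantumManyBody.BoseGas.sideLength ρ N := fun N hN => by
    unfold Literature.MathematicalPhysics.QuantumManyBody.BoseGas.sideLength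
    exact Real.rpow_pos_of_pos (div_pos (Nat.cast_pos.mpr hN) hρ) _
  -- BEC of `v` at density `ρ`, read on ground states through CGE (losing a factor 2)
  obtain ⟨c₀, hc₀, hev₀⟩ := hBEC ρ hρ h0
  have hGSv : ∀ᶠ N : ℕ in Filter.atTop,
      ∃ Ψ : Literature.MathematicalPhysics.QuantumManyBody.BoseGas.Config N → ℂ,
        Literature.MathematicalPhysics.QuantumManyBody.BoseGas.IsGroundState v
          (Literature.MathematicalPhysics.QuantumManyBody.BoseGas.sideLength ρ N) Ψ ∧
        ENNReal.ofReal (c₀ / 2 * N) ≤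
          Literature.MathematicalPhysics.QuantumManyBody.BoseGas.maxOccupation N Ψ := by
    filter_upwards [hev₀, Filter.eventually_gt_atTop 0] with N hN hNpos
    have hNR : (0 : ℝ) < N := Nat.cast_pos.mpr hNpos
    have hlt : ENNReal.ofReal (c₀ / 2 * N) < ENNReal.ofReal (c₀ * N) := by
      rw [ENNReal.ofReal_lt_ofReal_iff (mul_pos hc₀ hNR)]
      nlinarith
    exact hCGE v hv hvM N hNpos _ (hL N hNpos) _ _ hlt hN
  -- uniform slack transfer to the tame equal-`a` class of range `≤ R`
  obtain ⟨c, hc, hev⟩ := hT ρ hρ h1 (c₀ / 2) (half_pos hc₀) hGSv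
  refine ⟨c, hc, ?_⟩
  filter_upwards [hev, Filter.eventually_gt_atTop 0] with N hN hNpos
  obtain ⟨δ₀, hδ₀, hU⟩ := hN
  -- meet `w` at the fixed volume `L_N` by inclusion of near-minimiser sets
  obtain ⟨δ, hδ, u, hu, huM, huR, hua, hincl⟩ :=
    hS N (Literature.MathematicalPhysics.QuantumManyBody.BoseGas.sideLength ρ N) hNpos (hL N hNpos)
      δ₀ hδ₀
  refine Literature.MathematicalPhysics.QuantumManyBody.BoseGas.le_condensateNumber w hδ
    fun Ψ hΨ => ?_
  exact hU u hu huM huR (hua.trans hvw.symm) Ψ (hincl Ψ hΨ)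

/-- **Registration form** at the type of the item's primary-route copy of the shared crux
(`BECChargeConjugationRP.ScatteringLengthTransfer`, definitionally equal to the
`BECEqualScatteringTransfer` copy concluded by `_of`). It USES the three sorried stubs and is
therefore NOT a proof of the crux — only the certificate that the stubs compose to it. -/
theorem ScatteringLengthTransfer_proof :
    Summit.AtomisticToContinuum.BoseEinsteinCondensation.Theses.BECChargeConjugationRP.ScatteringLengthTransfer :=
  ScatteringLengthTransfer_of stub_condensedGroundState stub_slackSoftening stub_uniformSlackTransfer

end Summit.AtomisticToContinuum.BoseEinsteinCondensation.Cruxes.ScatteringLengthTransfer.Slack
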